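import Mathlib
import Literature.Claims.NS.Shahmurov2026
import HarnessLib

/-!
# NS-claims map, C11 (Shahmurov 2026, arXiv:2605.09797 v2 = `T`): kernel checks of the typed proof
# skeleton `Literature.Claims.NS.Shahmurov2026`

Negations of the §5 steps of the typed skeleton, each by ONE explicit model of the abstract pair class
`PairClass` (T §5, p.14) in which the hypothesis of the step — Prop 5.1's normalised output `𝔸[g,h] = 1`,
`𝕁[g,h] = Λ_*`, `Λ_* > 0` — is instantiated (print locators: R. Shahmurov, *A Classical Two-Part
First-Threshold Proof of Global Smoothness for Navier–Stokes*, arXiv:2605.09797 v2, 2026-05-15):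

* `not_Prop52` — Proposition 5.2 "Endpoint quotient Euler identities" (17)–(18) (statement p.14, proof
  p.15; skeleton decl `Prop52`, consumed by `strictBridge_of_steps` / `claim_of_steps`). By the skeleton's
  own `noSaturatingProfile_of_prop52`, (17) ∧ (18) ∧ `𝕁 = Λ_*𝔸` ∧ `𝔸 = 1` force `Λ_* = 0`, so Prop 5.2
  as printed holds iff NO pair class carries a profile with `𝔸 = 1`, `𝕁 > 0`; the model `powerLawClass`
  below carries one (`𝔸 = 1`, `𝕁 = 28/125`), hence `¬ NoSaturatingProfile` and `¬ Prop52`.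
* `not_Prop53` — Proposition 5.3 "Zero-error localized Pohozaev–Morawetz identity" (20) (p.15; skeleton
  decl `Prop53`, on the path, not consumed): in the same model, equipped with the printed dilation laws
  (`V, W` of degree `2`, `J₁, J₂` of degree `3/2`, p.15), (20) reads `(3/2)·(28/125) = 2·(28/125)·1`.
* `not_Prop52Stationarity`, `not_Prop53Stationarity` — the «implicit» stationarity premises of the two
  printed proofs (l.783–787, l.844, p.15; skeleton decls `Prop52Stationarity`, `Prop53Stationarity`) are
  false as well, by the skeleton's `prop52_of_stationarity` / `prop53_of_stationarity`.

The model: both carriers are pairs `(a, σ)` of positive reals («amplitude, scale»), `J₁(a,σ) = a³σ^{3/2}`,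
`J₂((a,σ),(b,τ)) = ab²(στ)^{3/4}`, `V(a,σ) = a²σ²`, `W(b,τ) = b²τ²`, `α = β = 1`, amplitude actions
`a ↦ a'a`, `b ↦ b'b`, dilation `σ ↦ sσ`, `τ ↦ sτ`; the nine printed scaling laws hold identically. Witness
pair `g = (4/5, 1)`, `h = (3/5, 1)`: `𝔸 = 16/25 + 9/25 = 1`, `𝕁 = 64/125 − 36/125 = 28/125 > 0`.
What the theorems locate: the abstract Steps `Prop52` / `Prop53` are false; the load-bearing Theorem 5.4
(`StrictBridge K`, p.15), whose printed proof is Prop 5.1 + Prop 5.2 (+ Prop 5.3), is left without its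
printed proof (its statement, over the paper's prose bookkeeping `K`, is not addressed here).
Axioms: `propext`, `Classical.choice`, `Quot.sound` only.
WHAT THIS IS NOT: not a claim about NS regularity or blow-up; not a claim about any author beyond
the typed locator.
-/

noncomputable section

-- The summit's canonical theorem namespace repeats the summit name (single-conjunct summit).
set_option linter.dupNamespace false

namespace Summit.NavierStokesRegularity.NavierStokesRegularity.Theorems.Shahmurov2026

open Literature.Claims.NS.Shahmurov2026

/-- Carrier of the model: pairs `(amplitude, scale)` of positive reals. -/
abbrev Car : Type := {p : ℝ × ℝ // 0 < p.1 ∧ 0 < p.2}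

/-- **The power-law pair class**: `J₁(a,σ) = a³σ^{3/2}`, `J₂((a,σ),(b,τ)) = ab²(στ)^{3/4}`,
`V(a,σ) = a²σ²`, `W(b,τ) = b²τ²`, `α = β = 1`, amplitude actions on the first coordinate (junk: identity
for non-positive parameters). The five printed amplitude laws (T p.15, l.788–797) hold identically. -/
def powerLawClass : PairClass where
  CarrierG := Car
  CarrierH := Car
  J₁ g := g.1.1 ^ 3 * g.1.2 ^ (3 / 2 : ℝ)
  J₂ g h := g.1.1 * h.1.1 ^ 2 * (g.1.2 * h.1.2) ^ (3 / 4 : ℝ)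
  V g := g.1.1 ^ 2 * g.1.2 ^ 2
  W h := h.1.1 ^ 2 * h.1.2 ^ 2
  α := 1
  β := 1
  α_pos := one_pos
  β_pos := one_pos
  ampG a g := if ha : 0 < a then ⟨(a * g.1.1, g.1.2), ⟨mul_pos ha g.2.1, g.2.2⟩⟩ else g
  ampH b h := if hb : 0 < b then ⟨(b * h.1.1, h.1.2), ⟨mul_pos hb h.2.1, h.2.2⟩⟩ else h
  J₁_ampG a ha g := by simp [ha]; ring
  J₂_ampG a ha g h := by simp [ha]; ring
  V_ampG a ha g := by simp [ha]; ring
  J₂_ampH b hb g h := by simp [hb]; ring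
  W_ampH b hb h := by simp [hb]; ring

/-- **Dilation data for the power-law class**: `σ ↦ sσ`, `τ ↦ sτ` (junk: identity for `s ≤ 0`); the four
printed dilation laws (T p.15, l.824–836: degree `2` for `V, W`, degree `3/2` for `J₁, J₂`) hold
identically. -/
def powerLawDilation : powerLawClass.Dilation where
  dilG s g := if hs : 0 < s then ⟨(g.1.1, s * g.1.2), ⟨g.2.1, mul_pos hs g.2.2⟩⟩ else g
  dilH s h := if hs : 0 < s then ⟨(h.1.1, s * h.1.2), ⟨h.2.1, mul_pos hs h.2.2⟩⟩ else h
  V_dil s hs g := by simp [powerLawClass, hs]; ring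
  W_dil s hs h := by simp [powerLawClass, hs]; ring
  J₁_dil s hs g := by
    simp only [powerLawClass, hs, dite_true]
    rw [Real.mul_rpow hs.le g.2.2.le]
    ring
  J₂_dil s hs g h := by
    simp only [powerLawClass, hs, dite_true]
    have e : s * g.1.2 * (s * h.1.2) = s ^ 2 * (g.1.2 * h.1.2) := by ring
    rw [e, Real.mul_rpow (by positivity) (mul_pos g.2.2 h.2.2).le, ← Real.rpow_natCast s 2,
      ← Real.rpow_mul hs.le]
    norm_num
    ring

/-- Witness `g = (4/5, 1)`. -/
def gW : Car := ⟨((4 : ℝ) / 5, 1), by norm_num⟩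

/-- Witness `h = (3/5, 1)`. -/
def hW : Car := ⟨((3 : ℝ) / 5, 1), by norm_num⟩

/-- `𝔸[g,h] = V + βW = 16/25 + 9/25 = 1`. -/
theorem A_witness : powerLawClass.A gW hW = 1 := by
  simp [PairClass.A, powerLawClass, gW, hW]
  norm_num

/-- `𝕁[g,h] = J₁ − αJ₂ = 64/125 − 36/125 = 28/125`. -/
theorem J_witness : powerLawClass.J gW hW = 28 / 125 := by
  simp [PairClass.J, powerLawClass, gW, hW]
  norm_num

/-- **A saturating profile exists** in some pair class: `¬ NoSaturatingProfile` (the content Thm 5.4's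
printed proof needs, skeleton decl `NoSaturatingProfile`, p.15). -/
theorem not_NoSaturatingProfile : ¬ NoSaturatingProfile := fun H =>
  H powerLawClass gW hW (28 / 125) A_witness J_witness (by norm_num)

/-- **Refutes `Prop52`** (Proposition 5.2, (17)–(18), statement p.14, proof p.15): by the skeleton's
`noSaturatingProfile_of_prop52`, Prop 5.2 as printed excludes every profile with `𝔸 = 1`, `𝕁 > 0` in every
pair class; `powerLawClass` has one. -/
theorem not_Prop52 : ¬ Prop52 := fun h52 =>
  not_NoSaturatingProfile (noSaturatingProfile_of_prop52 h52)

/-- **Refutes `Prop53`** (Proposition 5.3, (20), p.15): in `powerLawClass` with `powerLawDilation`, at the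
witness pair (20) reads `(3/2)·(28/125) = 2·(28/125)·1`. -/
theorem not_Prop53 : ¬ Prop53 := by
  intro h53
  have e := h53 powerLawClass powerLawDilation gW hW (28 / 125) A_witness J_witness (by norm_num)
  rw [A_witness, J_witness] at e
  norm_num at e

/-- The «implicit» amplitude-stationarity premise of the printed proof of Prop 5.2 (l.783–787, p.15) is
false: it implies `Prop52` (skeleton `prop52_of_stationarity`). -/
theorem not_Prop52Stationarity : ¬ Prop52Stationarity := fun h =>
  not_Prop52 (prop52_of_stationarity h)

/-- The «implicit» dilation-stationarity premise of the printed proof of Prop 5.3 (l.844, p.15) is false: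
it implies `Prop53` (skeleton `prop53_of_stationarity`). -/
theorem not_Prop53Stationarity : ¬ Prop53Stationarity := fun h =>
  not_Prop53 (prop53_of_stationarity h)

/-- **Model-free form** (for the referee): Prop 5.3 as printed is likewise equivalent to «no pair class with
dilation data carries a profile with `𝔸 = 1`, `𝕁 > 0`» — (20) with `𝔸 = 1`, `𝕁 = Λ_*` reads
`(3/2)Λ_* = 2Λ_*`. -/
theorem prop53_iff_noSaturating :
    Prop53 ↔ ∀ (C : PairClass) (_D : C.Dilation) (g : C.CarrierG) (h : C.CarrierH) (Λ : ℝ),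
      C.A g h = 1 → C.J g h = Λ → ¬ 0 < Λ := by
  constructor
  · intro H C D g h Λ hA hJ hΛ
    have e := H C D g h Λ hA hJ hΛ
    rw [hA, hJ] at e
    linarith
  · intro H C D g h Λ hA hJ hΛ
    exact absurd hΛ (H C D g h Λ hA hJ)

end Summit.NavierStokesRegularity.NavierStokesRegularity.Theorems.Shahmurov2026

end
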